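import Mathlib.Analysis.Calculus.Deriv.MeanValue
import Literature.Dynamics.Hyperbolic.HyperbolicSemiflowModelOrbits

/-!
# Quantitative transit times of a `C²` local semiflow model along arbitrary orbits of `Λ`

Topic `Literature/Dynamics/Hyperbolic`.  Fully proved theorems (no definitions, no named facts) continuing
`HyperbolicSemiflowModelOrbits.lean` for the standing hypotheses `h : IsHyperbolicSemiflowModel U Λ g m` (a local semiflow `g`
on an open set `U` of a real Banach space, jointly `C²` on `(0,2) × U`, compact invariant `Λ ⊆ U`; Lian–Young 2012 §1).  The
qualitative transit-time / Poincaré-map package at a point `x₀ ∈ Λ` (`HyperbolicSemiflowModelGlue.exists_transitTime_poincareMap`,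
implicit function theorem) has radii depending on `x₀` in an uncontrolled way.  Along an ARBITRARY orbit of `Λ` the intermediate
points may come close to equilibria, so the closing lemma along Pesin sets (`HasAmbientClosing`, registered stub `stub_ambientClosing`
of the Navier–Stokes line `ergodic-budget-selection-closing`, `Summits/AnomalousDissipation`) needs the radii and Lipschitz constants
of the transit time to depend POLYNOMIALLY on the transversality `α = ℓ (X(g₁ x₀))` of the section `{z | ℓ (z − g₁ x₀) = 0}` to the
flow direction `X = flowDir g`, with all other constants uniform over `Λ`.  This file proves exactly that, by the elementary route
"strict monotonicity in time + intermediate value theorem" instead of the implicit function theorem: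

* §1 `exists_zero_of_hasDerivAt_ge` — QUANTITATIVE SCALAR CROSSING: a real function with derivative `≥ μ > 0` on `[a − s, a + s]` and
  `|φ a| < μ s` has a zero `t₀` in the open window, and `μ |t − t₀| ≤ |φ t|` on the window (uniqueness and Lipschitz control at once);
  `exists_forall_norm_le_near_isCompact` — a map continuous on `D` is bounded near a compact `K ⊆ D`.
* §2 `exists_uniform_fderiv_estimates` — UNIFORM `C²` ESTIMATES NEAR `[1/2, 3/2] × Λ`: one radius `r ∈ (0, 1/2]`, a bound `M ≥ 1` of
  `‖D g‖` and a Lipschitz constant `L` of `D g` on the `r`-balls (sup metric of `ℝ × E`) around the points of `[1/2, 3/2] × Λ`, all inside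
  `(0,2) × U` (continuity of `D g` and `D² g` on the open `(0,2) × U`, compactness, mean value theorem on convex balls); consequences
  `dist_map_le_of_dist_lt` (the maps `g_t`, `t ∈ [1/2, 3/2]`, are `M`-Lipschitz on `ball x₀ r`, `x₀ ∈ Λ`), `hasDerivAt_orbit_of_dist_lt`,
  `dist_orbit_le_of_dist_lt` (orbits of points of `ball x₀ r` are `M`-Lipschitz in time on `[1/2, 3/2]`), `le_apply_fderiv_of_dist_lt`
  (the speed across the section drops at most by `L · max (|t − 1|, dist y x₀)`: `ℓ (∂ₜ g (t, y)) ≥ ℓ (X(g₁ x₀)) − L max (|t − 1|, dist y x₀)`).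
* §3 `exists_transitTime_lipschitz` — THE QUANTITATIVE TRANSIT TIME.  There is ONE constant `C ≥ 1` such that for all `x₀ ∈ Λ`, all
  functionals `‖ℓ‖ ≤ 1` and all `0 < α ≤ ℓ (flowDir g (g 1 x₀))`, with `s = α / C ≤ 1/4`: for `dist y x₀ < s²` and `t ∈ [1 − s, 1 + s]`
  the point `(t, y)` lies in `(0,2) × U` and `ℓ (∂ₜ g (t, y)) ≥ α / 2`; `(t, y) ↦ g t y` is `C`-Lipschitz on `[1 − s, 1 + s] × ball x₀ s²`;
  and there is a transit time `τ` with `τ x₀ = 1`, `τ y ∈ (1 − s, 1 + s)`, `g (τ y) y` on the section `{z | ℓ (z − g 1 x₀) = 0}`,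
  `(α/2) |t − τ y| ≤ |ℓ (g t y − g 1 x₀)|` on the window (so `τ y` is the only crossing time there), `|τ y − 1| ≤ (C/α) dist y x₀`,
  and `τ`, `y ↦ g (τ y) y` are `(C/α)`-Lipschitz on `ball x₀ s²`.

## References

* A. Katok, *Lyapunov exponents, entropy and periodic orbits for diffeomorphisms*, Publ. Math. IHÉS 51 (1980) 137–173, §3. [Katok1980]
* Z. Lian, L.-S. Young, *Lyapunov exponents, periodic orbits, and horseshoes for semiflows on Hilbert spaces*, J. Amer. Math. Soc. 25
  (2012) 637–665, §1. [LianYoung2012]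
* S. Yu. Pilyugin, *Shadowing in Dynamical Systems*, LNM 1706 (1999), §1.5 (transversal sections, reparametrisation). [Pilyugin1999]
-/

noncomputable section

open Set Function Metric Filter
open scoped Topology

namespace Literature.Dynamics.Hyperbolic

/-! ## §1 A quantitative scalar crossing lemma; bounds near a compact set -/

/-- **Quantitative scalar crossing.**  If `φ : ℝ → ℝ` has derivative `φ' ≥ μ` on `[a − s, a + s]` (`s > 0`) and `|φ a| < μ s`
(so `μ > 0`), then `φ` has a zero `t₀ ∈ (a − s, a + s)`, and `μ |t − t₀| ≤ |φ t|` for every `t ∈ [a − s, a + s]` (in particular `t₀` is the only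
zero in the window and `|t₀ − a| ≤ |φ a| / μ`). [folklore] -/
theorem exists_zero_of_hasDerivAt_ge {φ φ' : ℝ → ℝ} {a s μ : ℝ} (hs : 0 < s)
    (hderiv : ∀ t ∈ Icc (a - s) (a + s), HasDerivAt φ (φ' t) t) (hge : ∀ t ∈ Icc (a - s) (a + s), μ ≤ φ' t)
    (h0 : |φ a| < μ * s) :
    ∃ t₀ ∈ Ioo (a - s) (a + s), φ t₀ = 0 ∧ ∀ t ∈ Icc (a - s) (a + s), μ * |t - t₀| ≤ |φ t| := by
  have hcont : ContinuousOn φ (Icc (a - s) (a + s)) := fun t ht => (hderiv t ht).continuousAt.continuousWithinAt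
  have hdiff : DifferentiableOn ℝ φ (interior (Icc (a - s) (a + s))) := fun t ht =>
    (hderiv t (interior_subset ht)).differentiableAt.differentiableWithinAt
  have hge' : ∀ t ∈ interior (Icc (a - s) (a + s)), μ ≤ deriv φ t := fun t ht => by
    rw [(hderiv t (interior_subset ht)).deriv]; exact hge t (interior_subset ht)
  have hmvt := Convex.mul_sub_le_image_sub_of_le_deriv (convex_Icc (a - s) (a + s)) hcont hdiff hge'
  have ha : a ∈ Icc (a - s) (a + s) := ⟨by linarith, by linarith⟩
  have hl : a - s ∈ Icc (a - s) (a + s) := left_mem_Icc.2 (by linarith)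
  have hr : a + s ∈ Icc (a - s) (a + s) := right_mem_Icc.2 (by linarith)
  have h1 := hmvt a ha (a + s) hr (by linarith)
  have h2 := hmvt (a - s) hl a ha (by linarith)
  have e1 : μ * (a + s - a) = μ * s := by ring
  have e2 : μ * (a - (a - s)) = μ * s := by ring
  rw [e1] at h1
  rw [e2] at h2
  have hφa := abs_lt.1 h0
  have hpos : 0 < φ (a + s) := by linarith [hφa.1]
  have hneg : φ (a - s) < 0 := by linarith [hφa.2]
  obtain ⟨t₀, ht₀, hφt₀⟩ := intermediate_value_Icc (by linarith : a - s ≤ a + s) hcont ⟨hneg.le, hpos.le⟩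
  have ht₀o : t₀ ∈ Ioo (a - s) (a + s) := by
    refine ⟨lt_of_le_of_ne ht₀.1 ?_, lt_of_le_of_ne ht₀.2 ?_⟩
    · intro heq; rw [← heq] at hφt₀; exact hneg.ne hφt₀
    · intro heq; rw [heq] at hφt₀; exact hpos.ne' hφt₀
  refine ⟨t₀, ht₀o, hφt₀, fun t ht => ?_⟩
  rcases le_total t t₀ with htt | htt
  · have h3 := hmvt t ht t₀ ht₀ htt
    rw [hφt₀, zero_sub] at h3
    rw [abs_sub_comm, abs_of_nonneg (sub_nonneg.2 htt)]
    exact h3.trans (neg_le_abs _)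
  · have h3 := hmvt t₀ ht₀ t ht htt
    rw [hφt₀, sub_zero] at h3
    rw [abs_of_nonneg (sub_nonneg.2 htt)]
    exact h3.trans (le_abs_self _)

/-- **A map continuous on `D` is bounded near a compact `K ⊆ D`**: there are `δ > 0` and `M` with `‖f y‖ ≤ M` for all `y ∈ D` within `δ`
of a point of `K`. [folklore] -/
theorem exists_forall_norm_le_near_isCompact {α F : Type*} [PseudoMetricSpace α] [SeminormedAddCommGroup F] {f : α → F}
    {D K : Set α} (hf : ContinuousOn f D) (hK : IsCompact K) (hKD : K ⊆ D) :
    ∃ δ > 0, ∃ M : ℝ, ∀ x ∈ K, ∀ y ∈ D, dist y x < δ → ‖f y‖ ≤ M := by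
  obtain ⟨M₀, hM₀⟩ := hK.exists_bound_of_continuousOn (hf.mono hKD)
  obtain ⟨δ, hδ, hosc⟩ := exists_forall_dist_lt_of_continuousOn hf hK hKD one_pos
  refine ⟨δ, hδ, M₀ + 1, fun x hx y hy hyx => ?_⟩
  have h1 := hosc x hx y hy hyx
  rw [dist_eq_norm] at h1
  calc ‖f y‖ = ‖f x + (f y - f x)‖ := by rw [add_sub_cancel]
    _ ≤ ‖f x‖ + ‖f y - f x‖ := norm_add_le _ _
    _ ≤ M₀ + 1 := add_le_add (hM₀ x hx) h1.le

namespace IsHyperbolicSemiflowModel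

variable {E : Type*} [NormedAddCommGroup E] [NormedSpace ℝ E] [MeasurableSpace E]
  {U Λ : Set E} {g : ℝ → E → E} {m : MeasureTheory.Measure E}

/-! ## §2 Uniform `C²` estimates near `[1/2, 3/2] × Λ` -/

/-- A uniform radius `r ∈ (0, 1/2]` such that every point of `ℝ × E` within `r` (sup metric) of `[1/2, 3/2] × Λ` lies in `(0,2) × U`.
[folklore] -/
theorem exists_forall_mem_prod_of_dist_lt (h : IsHyperbolicSemiflowModel U Λ g m) :
    ∃ r > 0, r ≤ 1 / 2 ∧ ∀ q ∈ Icc (1 / 2 : ℝ) (3 / 2) ×ˢ Λ, ∀ q' : ℝ × E, dist q' q < r → q' ∈ Ioo (0 : ℝ) 2 ×ˢ U := by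
  obtain ⟨r₀, hr₀, hU⟩ := h.exists_forall_mem_of_dist_lt
  refine ⟨min r₀ (1 / 2), lt_min hr₀ (by norm_num), min_le_right _ _, fun q hq q' hq' => ?_⟩
  rw [Prod.dist_eq, max_lt_iff] at hq'
  obtain ⟨⟨hq1, hq1'⟩, hq2⟩ := hq
  have ht : |q'.1 - q.1| < 1 / 2 := by
    have h1 := hq'.1.trans_le (min_le_right _ _)
    rwa [Real.dist_eq] at h1
  refine ⟨⟨?_, ?_⟩, hU q.2 hq2 q'.2 (hq'.2.trans_le (min_le_left _ _))⟩
  · have h1 := (abs_lt.1 ht).1; linarith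
  · have h1 := (abs_lt.1 ht).2; linarith

/-- **Uniform first- and second-order estimates near `[1/2, 3/2] × Λ`.**  There are `r ∈ (0, 1/2]`, `M ≥ 1` and `L ≥ 0` such that for
every `q ∈ [1/2, 3/2] × Λ` and all `q', q''` within `r` of `q` (sup metric of `ℝ × E`): `q' ∈ (0,2) × U`, `‖D g (q')‖ ≤ M`, and
`‖D g (q') − D g (q'')‖ ≤ L ‖q' − q''‖` (`D g` the joint Fréchet derivative; continuity of `D g`, `D² g` on the open `(0,2) × U` where
the model is `C²`, compactness of `[1/2, 3/2] × Λ`, and the mean value theorem on the convex balls). [folklore] -/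
theorem exists_uniform_fderiv_estimates (h : IsHyperbolicSemiflowModel U Λ g m) :
    ∃ r > 0, r ≤ 1 / 2 ∧ ∃ M L : ℝ, 1 ≤ M ∧ 0 ≤ L ∧
      (∀ q ∈ Icc (1 / 2 : ℝ) (3 / 2) ×ˢ Λ, ∀ q' : ℝ × E, dist q' q < r → q' ∈ Ioo (0 : ℝ) 2 ×ˢ U) ∧
      (∀ q ∈ Icc (1 / 2 : ℝ) (3 / 2) ×ˢ Λ, ∀ q' : ℝ × E, dist q' q < r → ‖fderiv ℝ (fun p : ℝ × E => g p.1 p.2) q'‖ ≤ M) ∧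
      ∀ q ∈ Icc (1 / 2 : ℝ) (3 / 2) ×ˢ Λ, ∀ q' q'' : ℝ × E, dist q' q < r → dist q'' q < r →
        ‖fderiv ℝ (fun p : ℝ × E => g p.1 p.2) q' - fderiv ℝ (fun p : ℝ × E => g p.1 p.2) q''‖ ≤ L * ‖q' - q''‖ := by
  have hW : IsOpen (Ioo (0 : ℝ) 2 ×ˢ U) := isOpen_Ioo.prod h.isOpen
  have hK : IsCompact (Icc (1 / 2 : ℝ) (3 / 2) ×ˢ Λ) := isCompact_Icc.prod h.isCompact
  have hKW : Icc (1 / 2 : ℝ) (3 / 2) ×ˢ Λ ⊆ Ioo (0 : ℝ) 2 ×ˢ U :=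
    prod_mono (Icc_subset_Ioo (by norm_num) (by norm_num)) h.subset
  set G : ℝ × E → E := fun p => g p.1 p.2 with hG
  have hc1 : ContinuousOn (fderiv ℝ G) (Ioo (0 : ℝ) 2 ×ˢ U) := h.contDiffOn.continuousOn_fderiv_of_isOpen hW (by norm_num)
  have hd1 : ContDiffOn ℝ 1 (fderiv ℝ G) (Ioo (0 : ℝ) 2 ×ˢ U) := h.contDiffOn.fderiv_of_isOpen hW (by norm_num)
  have hc2 : ContinuousOn (fderiv ℝ (fderiv ℝ G)) (Ioo (0 : ℝ) 2 ×ˢ U) := hd1.continuousOn_fderiv_of_isOpen hW le_rfl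
  obtain ⟨r₁, hr₁, hr₁2, hmem⟩ := h.exists_forall_mem_prod_of_dist_lt
  obtain ⟨δ₁, hδ₁, M₀, hM₀⟩ := exists_forall_norm_le_near_isCompact (f := fderiv ℝ G) hc1 hK hKW
  obtain ⟨δ₂, hδ₂, L₀, hL₀⟩ := exists_forall_norm_le_near_isCompact (f := fderiv ℝ (fderiv ℝ G)) hc2 hK hKW
  set r : ℝ := min r₁ (min δ₁ δ₂) with hr
  have hr_r₁ : r ≤ r₁ := min_le_left _ _
  have hr_δ₁ : r ≤ δ₁ := (min_le_right _ _).trans (min_le_left _ _)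
  have hr_δ₂ : r ≤ δ₂ := (min_le_right _ _).trans (min_le_right _ _)
  refine ⟨r, lt_min hr₁ (lt_min hδ₁ hδ₂), hr_r₁.trans hr₁2, max M₀ 1, max L₀ 0, le_max_right _ _, le_max_right _ _,
    fun q hq q' hq' => hmem q hq q' (hq'.trans_le hr_r₁),
    fun q hq q' hq' => (hM₀ q hq q' (hmem q hq q' (hq'.trans_le hr_r₁)) (hq'.trans_le hr_δ₁)).trans (le_max_left _ _),
    fun q hq q' q'' hq' hq'' => ?_⟩
  have hball : ∀ p ∈ ball q r, p ∈ Ioo (0 : ℝ) 2 ×ˢ U := fun p hp => hmem q hq p ((mem_ball.1 hp).trans_le hr_r₁)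
  have hdiff : ∀ p ∈ ball q r, DifferentiableAt ℝ (fderiv ℝ G) p := fun p hp =>
    (hd1.differentiableOn one_ne_zero).differentiableAt (hW.mem_nhds (hball p hp))
  have hbd : ∀ p ∈ ball q r, ‖fderiv ℝ (fderiv ℝ G) p‖ ≤ max L₀ 0 := fun p hp =>
    (hL₀ q hq p (hball p hp) ((mem_ball.1 hp).trans_le hr_δ₂)).trans (le_max_left _ _)
  exact Convex.norm_image_sub_le_of_norm_fderiv_le hdiff hbd (convex_ball q r) (mem_ball.2 hq'') (mem_ball.2 hq')

/-- **The maps `g_t`, `t ∈ [1/2, 3/2]`, are uniformly Lipschitz near `Λ`**: if the `r`-neighbourhood of `[1/2, 3/2] × Λ` lies in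
`(0,2) × U` and `‖D g‖ ≤ M` there, then `dist (g t y) (g t y') ≤ M dist y y'` for `y, y' ∈ ball x₀ r`, `x₀ ∈ Λ` (mean value theorem
on the convex ball). [folklore] -/
theorem dist_map_le_of_dist_lt (h : IsHyperbolicSemiflowModel U Λ g m) {r M : ℝ}
    (hWr : ∀ q ∈ Icc (1 / 2 : ℝ) (3 / 2) ×ˢ Λ, ∀ q' : ℝ × E, dist q' q < r → q' ∈ Ioo (0 : ℝ) 2 ×ˢ U)
    (hM : ∀ q ∈ Icc (1 / 2 : ℝ) (3 / 2) ×ˢ Λ, ∀ q' : ℝ × E, dist q' q < r → ‖fderiv ℝ (fun p : ℝ × E => g p.1 p.2) q'‖ ≤ M)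
    {x₀ : E} (hx₀ : x₀ ∈ Λ) {t : ℝ} (ht : t ∈ Icc (1 / 2 : ℝ) (3 / 2)) {y y' : E} (hy : dist y x₀ < r) (hy' : dist y' x₀ < r) :
    dist (g t y) (g t y') ≤ M * dist y y' := by
  have hq : ((t, x₀) : ℝ × E) ∈ Icc (1 / 2 : ℝ) (3 / 2) ×ˢ Λ := ⟨ht, hx₀⟩
  have hb : ∀ z ∈ ball x₀ r, ((t, z) : ℝ × E) ∈ Ioo (0 : ℝ) 2 ×ˢ U ∧ ‖fderiv ℝ (fun p : ℝ × E => g p.1 p.2) (t, z)‖ ≤ M := by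
    intro z hz
    have hd : dist ((t, z) : ℝ × E) (t, x₀) < r := by
      rw [Prod.dist_eq, dist_self, max_eq_right dist_nonneg]; exact mem_ball.1 hz
    exact ⟨hWr _ hq _ hd, hM _ hq _ hd⟩
  have hderiv : ∀ z ∈ ball x₀ r, HasFDerivWithinAt (g t)
      ((fderiv ℝ (fun p : ℝ × E => g p.1 p.2) (t, z)).comp (ContinuousLinearMap.inr ℝ ℝ E)) (ball x₀ r) z :=
    fun z hz => (h.hasFDerivAt_map (hb z hz).1.2 (hb z hz).1.1).hasFDerivWithinAt
  have hbound : ∀ z ∈ ball x₀ r, ‖(fderiv ℝ (fun p : ℝ × E => g p.1 p.2) (t, z)).comp (ContinuousLinearMap.inr ℝ ℝ E)‖ ≤ M := by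
    intro z hz
    refine (ContinuousLinearMap.opNorm_comp_le _ _).trans ?_
    calc ‖fderiv ℝ (fun p : ℝ × E => g p.1 p.2) (t, z)‖ * ‖ContinuousLinearMap.inr ℝ ℝ E‖
        ≤ ‖fderiv ℝ (fun p : ℝ × E => g p.1 p.2) (t, z)‖ * 1 :=
          mul_le_mul_of_nonneg_left (ContinuousLinearMap.norm_inr_le_one ℝ ℝ E) (norm_nonneg _)
      _ ≤ M := by rw [mul_one]; exact (hb z hz).2
  have h1 := Convex.norm_image_sub_le_of_norm_hasFDerivWithin_le hderiv hbound (convex_ball x₀ r) (mem_ball.2 hy')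
    (mem_ball.2 hy)
  rw [dist_eq_norm, dist_eq_norm]
  exact h1

/-- **Orbits of points near `Λ` are differentiable at times in `[1/2, 3/2]`** with velocity `∂ₜ g (t, y) = D g (t, y) (1, 0)` of norm
`≤ M` (same hypotheses as `dist_map_le_of_dist_lt`). [folklore] -/
theorem hasDerivAt_orbit_of_dist_lt (h : IsHyperbolicSemiflowModel U Λ g m) {r M : ℝ}
    (hWr : ∀ q ∈ Icc (1 / 2 : ℝ) (3 / 2) ×ˢ Λ, ∀ q' : ℝ × E, dist q' q < r → q' ∈ Ioo (0 : ℝ) 2 ×ˢ U)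
    (hM : ∀ q ∈ Icc (1 / 2 : ℝ) (3 / 2) ×ˢ Λ, ∀ q' : ℝ × E, dist q' q < r → ‖fderiv ℝ (fun p : ℝ × E => g p.1 p.2) q'‖ ≤ M)
    {x₀ : E} (hx₀ : x₀ ∈ Λ) {t : ℝ} (ht : t ∈ Icc (1 / 2 : ℝ) (3 / 2)) {y : E} (hy : dist y x₀ < r) :
    HasDerivAt (fun s => g s y) (fderiv ℝ (fun p : ℝ × E => g p.1 p.2) (t, y) (1, 0)) t ∧
      ‖fderiv ℝ (fun p : ℝ × E => g p.1 p.2) (t, y) (1, 0)‖ ≤ M := by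
  have hq : ((t, x₀) : ℝ × E) ∈ Icc (1 / 2 : ℝ) (3 / 2) ×ˢ Λ := ⟨ht, hx₀⟩
  have hd : dist ((t, y) : ℝ × E) (t, x₀) < r := by
    rw [Prod.dist_eq, dist_self, max_eq_right dist_nonneg]; exact hy
  have hW := hWr _ hq _ hd
  refine ⟨h.hasDerivAt_orbit hW.2 hW.1, ?_⟩
  have h1 : ‖((1 : ℝ), (0 : E))‖ = 1 := by simp [Prod.norm_def]
  calc ‖fderiv ℝ (fun p : ℝ × E => g p.1 p.2) (t, y) (1, 0)‖
      ≤ ‖fderiv ℝ (fun p : ℝ × E => g p.1 p.2) (t, y)‖ * ‖((1 : ℝ), (0 : E))‖ := ContinuousLinearMap.le_opNorm _ _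
    _ ≤ M * 1 := by rw [h1]; exact mul_le_mul_of_nonneg_right (hM _ hq _ hd) zero_le_one
    _ = M := mul_one M

/-- **Orbits of points near `Λ` are `M`-Lipschitz in time on `[1/2, 3/2]`** (same hypotheses). [folklore] -/
theorem dist_orbit_le_of_dist_lt (h : IsHyperbolicSemiflowModel U Λ g m) {r M : ℝ}
    (hWr : ∀ q ∈ Icc (1 / 2 : ℝ) (3 / 2) ×ˢ Λ, ∀ q' : ℝ × E, dist q' q < r → q' ∈ Ioo (0 : ℝ) 2 ×ˢ U)
    (hM : ∀ q ∈ Icc (1 / 2 : ℝ) (3 / 2) ×ˢ Λ, ∀ q' : ℝ × E, dist q' q < r → ‖fderiv ℝ (fun p : ℝ × E => g p.1 p.2) q'‖ ≤ M)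
    {x₀ : E} (hx₀ : x₀ ∈ Λ) {y : E} (hy : dist y x₀ < r) {t t' : ℝ} (ht : t ∈ Icc (1 / 2 : ℝ) (3 / 2))
    (ht' : t' ∈ Icc (1 / 2 : ℝ) (3 / 2)) : dist (g t y) (g t' y) ≤ M * |t - t'| := by
  have key := fun s (hs : s ∈ Icc (1 / 2 : ℝ) (3 / 2)) => h.hasDerivAt_orbit_of_dist_lt hWr hM hx₀ hs hy
  have h1 := Convex.norm_image_sub_le_of_norm_hasDerivWithin_le (fun s hs => (key s hs).1.hasDerivWithinAt)
    (fun s hs => (key s hs).2) (convex_Icc (1 / 2 : ℝ) (3 / 2)) ht' ht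
  rw [dist_eq_norm, ← Real.norm_eq_abs]
  exact h1

/-- **Persistence of transversality, quantitatively.**  If `D g` is `L`-Lipschitz on the `r`-balls around points of `[1/2, 3/2] × Λ`,
then for `x₀ ∈ Λ`, `‖ℓ‖ ≤ 1`, `|t − 1| < r` and `dist y x₀ < r`:
`ℓ (∂ₜ g (t, y)) ≥ ℓ (flowDir g (g 1 x₀)) − L · max (|t − 1|) (dist y x₀)` (recall `flowDir g (g 1 x₀) = ∂ₜ g (1, x₀)`). [folklore] -/
theorem le_apply_fderiv_of_dist_lt (h : IsHyperbolicSemiflowModel U Λ g m) {r L : ℝ}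
    (hL : ∀ q ∈ Icc (1 / 2 : ℝ) (3 / 2) ×ˢ Λ, ∀ q' q'' : ℝ × E, dist q' q < r → dist q'' q < r →
      ‖fderiv ℝ (fun p : ℝ × E => g p.1 p.2) q' - fderiv ℝ (fun p : ℝ × E => g p.1 p.2) q''‖ ≤ L * ‖q' - q''‖)
    (hr : 0 < r) {x₀ : E} (hx₀ : x₀ ∈ Λ) {ℓ : E →L[ℝ] ℝ} (hℓ : ‖ℓ‖ ≤ 1) {t : ℝ} (ht : |t - 1| < r) {y : E}
    (hy : dist y x₀ < r) :
    ℓ (flowDir g (g 1 x₀)) - L * max |t - 1| (dist y x₀) ≤ ℓ (fderiv ℝ (fun p : ℝ × E => g p.1 p.2) (t, y) (1, 0)) := by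
  set DG := fderiv ℝ (fun p : ℝ × E => g p.1 p.2) with hDG
  have hq : ((1, x₀) : ℝ × E) ∈ Icc (1 / 2 : ℝ) (3 / 2) ×ˢ Λ := ⟨⟨by norm_num, by norm_num⟩, hx₀⟩
  have hd : dist ((t, y) : ℝ × E) (1, x₀) < r := by rw [Prod.dist_eq, Real.dist_eq]; exact max_lt ht hy
  have hd0 : dist ((1, x₀) : ℝ × E) (1, x₀) < r := by rw [dist_self]; exact hr
  have h1 := hL _ hq _ _ hd hd0
  have hnorm : ‖((t, y) : ℝ × E) - (1, x₀)‖ = max |t - 1| (dist y x₀) := by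
    rw [Prod.mk_sub_mk, Prod.norm_mk, Real.norm_eq_abs, dist_eq_norm]
  have h1n : ‖((1 : ℝ), (0 : E))‖ = 1 := by simp [Prod.norm_def]
  rw [h.flowDir_eq hx₀ rfl]
  have h2 : ℓ (DG (1, x₀) (1, 0)) - ℓ (DG (t, y) (1, 0)) ≤ L * max |t - 1| (dist y x₀) := by
    have e : ℓ (DG (1, x₀) (1, 0)) - ℓ (DG (t, y) (1, 0)) = ℓ ((DG (1, x₀) - DG (t, y)) (1, 0)) := by
      rw [_root_.sub_apply, _root_.map_sub]
    rw [e]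
    calc ℓ ((DG (1, x₀) - DG (t, y)) (1, 0)) ≤ |ℓ ((DG (1, x₀) - DG (t, y)) (1, 0))| := le_abs_self _
      _ = ‖ℓ ((DG (1, x₀) - DG (t, y)) (1, 0))‖ := (Real.norm_eq_abs _).symm
      _ ≤ ‖ℓ‖ * ‖(DG (1, x₀) - DG (t, y)) (1, 0)‖ := ℓ.le_opNorm _
      _ ≤ 1 * (‖DG (1, x₀) - DG (t, y)‖ * ‖((1 : ℝ), (0 : E))‖) :=
          mul_le_mul hℓ (ContinuousLinearMap.le_opNorm _ _) (norm_nonneg _) zero_le_one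
      _ = ‖DG (t, y) - DG (1, x₀)‖ := by rw [one_mul, h1n, mul_one, norm_sub_rev]
      _ ≤ L * ‖((t, y) : ℝ × E) - (1, x₀)‖ := h1
      _ = L * max |t - 1| (dist y x₀) := by rw [hnorm]
  linarith

/-! ## §3 The quantitative transit time -/

/-- **Quantitative transit times along `Λ` (block D5q of the closing lemma).**  There is a constant `C ≥ 1` such that for every
`x₀ ∈ Λ`, every functional `ℓ` with `‖ℓ‖ ≤ 1` and every `α` with `0 < α ≤ ℓ (flowDir g (g 1 x₀))` (transversality of the section
`{z | ℓ (z − g 1 x₀) = 0}` to the flow direction at `g 1 x₀`), writing `s = α / C` (`≤ 1/4`):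
* for `dist y x₀ < s²` and `t ∈ [1 − s, 1 + s]`: `(t, y) ∈ (0,2) × U` and `ℓ (∂ₜ g (t, y)) ≥ α / 2`;
* `(t, y) ↦ g t y` is `C`-Lipschitz on `[1 − s, 1 + s] × {dist y x₀ < s²}`: `dist (g t y) (g t' y') ≤ C (|t − t'| + dist y y')`;
* there is a TRANSIT TIME `τ : E → ℝ` with `τ x₀ = 1` such that for `dist y x₀ < s²`: `τ y ∈ (1 − s, 1 + s)`, `g (τ y) y` lies on
  the section, `|τ y − 1| ≤ (C/α) dist y x₀`, `(α/2) |t − τ y| ≤ |ℓ (g t y − g 1 x₀)|` for `t ∈ [1 − s, 1 + s]` (so `τ y` is the only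
  crossing time in the window), and `τ` and the Poincaré map `y ↦ g (τ y) y` are `(C/α)`-Lipschitz on `{dist y x₀ < s²}`.
All constants are uniform in `x₀ ∈ Λ`; only the transversality `α` enters, polynomially. [folklore] -/
theorem exists_transitTime_lipschitz (h : IsHyperbolicSemiflowModel U Λ g m) :
    ∃ C : ℝ, 1 ≤ C ∧ ∀ x₀ ∈ Λ, ∀ ℓ : E →L[ℝ] ℝ, ‖ℓ‖ ≤ 1 → ∀ α : ℝ, 0 < α → α ≤ ℓ (flowDir g (g 1 x₀)) →
      α / C ≤ 1 / 4 ∧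
      (∀ y : E, dist y x₀ < (α / C) ^ 2 → ∀ t ∈ Icc (1 - α / C) (1 + α / C),
        (t, y) ∈ Ioo (0 : ℝ) 2 ×ˢ U ∧ α / 2 ≤ ℓ (fderiv ℝ (fun p : ℝ × E => g p.1 p.2) (t, y) (1, 0))) ∧
      (∀ y y' : E, dist y x₀ < (α / C) ^ 2 → dist y' x₀ < (α / C) ^ 2 →
        ∀ t ∈ Icc (1 - α / C) (1 + α / C), ∀ t' ∈ Icc (1 - α / C) (1 + α / C),
          dist (g t y) (g t' y') ≤ C * (|t - t'| + dist y y')) ∧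
      ∃ τ : E → ℝ, τ x₀ = 1 ∧
        (∀ y : E, dist y x₀ < (α / C) ^ 2 →
          τ y ∈ Ioo (1 - α / C) (1 + α / C) ∧ ℓ (g (τ y) y - g 1 x₀) = 0 ∧ |τ y - 1| ≤ C / α * dist y x₀) ∧
        (∀ y : E, dist y x₀ < (α / C) ^ 2 → ∀ t ∈ Icc (1 - α / C) (1 + α / C),
          α / 2 * |t - τ y| ≤ |ℓ (g t y - g 1 x₀)|) ∧
        (∀ y y' : E, dist y x₀ < (α / C) ^ 2 → dist y' x₀ < (α / C) ^ 2 →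
          |τ y - τ y'| ≤ C / α * dist y y' ∧ dist (g (τ y) y) (g (τ y') y') ≤ C / α * dist y y') := by
  obtain ⟨r, hr, hr2, M, L, hM1, hL0, hWr, hMb, hLb⟩ := h.exists_uniform_fderiv_estimates
  set DG := fderiv ℝ (fun p : ℝ × E => g p.1 p.2) with hDG
  have hM0 : 0 < M := by linarith
  have hMsq : 0 ≤ M ^ 2 := sq_nonneg M
  have hMr : 0 < 2 * M / r := by positivity
  set C : ℝ := 3 * M ^ 2 + 2 * M / r + 2 * M + 2 * L + 1 with hC
  have hC1 : 1 ≤ C := by rw [hC]; linarith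
  have hC0 : 0 < C := by linarith
  have hCr : 2 * M / r ≤ C := by rw [hC]; linarith
  have hC2M : 2 * M < C := by rw [hC]; linarith
  have hC2L : 2 * L ≤ C := by rw [hC]; linarith
  have hC3M : 3 * M ^ 2 ≤ C := by rw [hC]; linarith
  have hCM : M ≤ C := by linarith
  refine ⟨C, hC1, fun x₀ hx₀ ℓ hℓ α hα hαℓ => ?_⟩
  have hx₀r : dist x₀ x₀ < r := by rw [dist_self]; exact hr
  have h1K : (1 : ℝ) ∈ Icc (1 / 2 : ℝ) (3 / 2) := ⟨by norm_num, by norm_num⟩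
  -- `α ≤ M`
  have hαM : α ≤ M := by
    obtain ⟨-, hb⟩ := h.hasDerivAt_orbit_of_dist_lt hWr hMb hx₀ h1K hx₀r
    calc α ≤ ℓ (flowDir g (g 1 x₀)) := hαℓ
      _ = ℓ (DG (1, x₀) (1, 0)) := by rw [h.flowDir_eq hx₀ rfl]
      _ ≤ |ℓ (DG (1, x₀) (1, 0))| := le_abs_self _
      _ = ‖ℓ (DG (1, x₀) (1, 0))‖ := (Real.norm_eq_abs _).symm
      _ ≤ ‖ℓ‖ * ‖DG (1, x₀) (1, 0)‖ := ℓ.le_opNorm _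
      _ ≤ 1 * M := mul_le_mul hℓ hb (norm_nonneg _) zero_le_one
      _ = M := one_mul M
  -- the window half-width `s = α / C`
  set s : ℝ := α / C with hs
  have hs0 : 0 < s := div_pos hα hC0
  have hsr2 : s ≤ r / 2 := by
    rw [hs, div_le_iff₀ hC0]
    calc α ≤ M := hαM
      _ = r / 2 * (2 * M / r) := by field_simp
      _ ≤ r / 2 * C := mul_le_mul_of_nonneg_left hCr (by linarith)
  have hsr : s < r := by linarith
  have hs4 : s ≤ 1 / 4 := by linarith
  have hs1 : s ≤ 1 := by linarith
  have hss : s ^ 2 ≤ s := by nlinarith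
  have hLs : L * s ≤ α / 2 := by
    rw [hs, mul_div_assoc', div_le_iff₀ hC0]
    nlinarith [mul_nonneg hα.le (sub_nonneg.2 hC2L)]
  have hMs : M * s < α / 2 := by
    rw [hs, mul_div_assoc', div_lt_iff₀ hC0]
    nlinarith [mul_pos hα (sub_pos.2 hC2M)]
  have hwin : ∀ t ∈ Icc (1 - s) (1 + s), t ∈ Icc (1 / 2 : ℝ) (3 / 2) ∧ |t - 1| < r ∧ |t - 1| ≤ s := fun t ht =>
    ⟨⟨by linarith [ht.1], by linarith [ht.2]⟩, by rw [abs_lt]; constructor <;> linarith [ht.1, ht.2],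
      by rw [abs_le]; constructor <;> linarith [ht.1, ht.2]⟩
  have hyr : ∀ y : E, dist y x₀ < s ^ 2 → dist y x₀ < r := fun y hy => by linarith
  -- (i) transversality on the box and the derivative of the crossing function
  have hder : ∀ y : E, dist y x₀ < s ^ 2 → ∀ t ∈ Icc (1 - s) (1 + s), (t, y) ∈ Ioo (0 : ℝ) 2 ×ˢ U ∧
      HasDerivAt (fun u => ℓ (g u y - g 1 x₀)) (ℓ (DG (t, y) (1, 0))) t ∧ α / 2 ≤ ℓ (DG (t, y) (1, 0)) := by
    intro y hy t ht
    obtain ⟨ht', ht1, hts⟩ := hwin t ht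
    have hy' := hyr y hy
    obtain ⟨hd, -⟩ := h.hasDerivAt_orbit_of_dist_lt hWr hMb hx₀ ht' hy'
    have hq : ((t, x₀) : ℝ × E) ∈ Icc (1 / 2 : ℝ) (3 / 2) ×ˢ Λ := ⟨ht', hx₀⟩
    have hdq : dist ((t, y) : ℝ × E) (t, x₀) < r := by
      rw [Prod.dist_eq, dist_self, max_eq_right dist_nonneg]; exact hy'
    refine ⟨hWr _ hq _ hdq, ℓ.hasFDerivAt.comp_hasDerivAt t (hd.sub_const (g 1 x₀)), ?_⟩
    have h1 := h.le_apply_fderiv_of_dist_lt hLb hr hx₀ hℓ ht1 hy'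
    have h2 : L * max |t - 1| (dist y x₀) ≤ L * s :=
      mul_le_mul_of_nonneg_left (max_le hts (by linarith)) hL0
    linarith
  -- (ii) joint Lipschitz continuity on the box
  have hlip : ∀ y y' : E, dist y x₀ < s ^ 2 → dist y' x₀ < s ^ 2 → ∀ t ∈ Icc (1 - s) (1 + s), ∀ t' ∈ Icc (1 - s) (1 + s),
      dist (g t y) (g t' y') ≤ M * |t - t'| + M * dist y y' := by
    intro y y' hy hy' t ht t' ht'
    calc dist (g t y) (g t' y') ≤ dist (g t y) (g t' y) + dist (g t' y) (g t' y') := dist_triangle _ _ _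
      _ ≤ M * |t - t'| + M * dist y y' :=
          add_le_add (h.dist_orbit_le_of_dist_lt hWr hMb hx₀ (hyr y hy) (hwin t ht).1 (hwin t' ht').1)
            (h.dist_map_le_of_dist_lt hWr hMb hx₀ (hwin t' ht').1 (hyr y hy) (hyr y' hy'))
  -- (iii) a bound for `|ℓ (g t y - g t y')|`
  have hℓg : ∀ y y' : E, dist y x₀ < s ^ 2 → dist y' x₀ < s ^ 2 → ∀ t ∈ Icc (1 - s) (1 + s),
      |ℓ (g t y - g t y')| ≤ M * dist y y' := by
    intro y y' hy hy' t ht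
    calc |ℓ (g t y - g t y')| = ‖ℓ (g t y - g t y')‖ := (Real.norm_eq_abs _).symm
      _ ≤ ‖ℓ‖ * ‖g t y - g t y'‖ := ℓ.le_opNorm _
      _ ≤ 1 * (M * dist y y') := by
          refine mul_le_mul hℓ ?_ (norm_nonneg _) zero_le_one
          rw [← dist_eq_norm]
          exact h.dist_map_le_of_dist_lt hWr hMb hx₀ (hwin t ht).1 (hyr y hy) (hyr y' hy')
      _ = M * dist y y' := one_mul _
  have hx₀s : dist x₀ x₀ < s ^ 2 := by rw [dist_self]; positivity
  have h1w : (1 : ℝ) ∈ Icc (1 - s) (1 + s) := ⟨by linarith, by linarith⟩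
  -- (iv) the scalar crossing lemma at every point of the ball
  have hτex : ∀ y : E, ∃ t₀ : ℝ, dist y x₀ < s ^ 2 → t₀ ∈ Ioo (1 - s) (1 + s) ∧ ℓ (g t₀ y - g 1 x₀) = 0 ∧
      ∀ t ∈ Icc (1 - s) (1 + s), α / 2 * |t - t₀| ≤ |ℓ (g t y - g 1 x₀)| := by
    intro y
    by_cases hy : dist y x₀ < s ^ 2
    · have h0 : |ℓ (g 1 y - g 1 x₀)| < α / 2 * s :=
        calc |ℓ (g 1 y - g 1 x₀)| ≤ M * dist y x₀ := hℓg y x₀ hy hx₀s 1 h1w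
          _ ≤ M * s ^ 2 := mul_le_mul_of_nonneg_left hy.le hM0.le
          _ = (M * s) * s := by ring
          _ < α / 2 * s := mul_lt_mul_of_pos_right hMs hs0
      obtain ⟨t₀, ht₀, h0', hq⟩ := exists_zero_of_hasDerivAt_ge (φ := fun u => ℓ (g u y - g 1 x₀))
        (φ' := fun u => ℓ (DG (u, y) (1, 0))) hs0 (fun t ht => (hder y hy t ht).2.1)
        (fun t ht => (hder y hy t ht).2.2) h0
      exact ⟨t₀, fun _ => ⟨ht₀, h0', hq⟩⟩
    · exact ⟨1, fun h' => absurd h' hy⟩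
  choose τ hτ using hτex
  -- `τ x₀ = 1`
  have hτx₀ : τ x₀ = 1 := by
    obtain ⟨-, -, hq⟩ := hτ x₀ hx₀s
    have h1 := hq 1 h1w
    rw [sub_self, _root_.map_zero, abs_zero] at h1
    have h2 : |1 - τ x₀| ≤ 0 := le_of_not_gt fun hc => absurd h1 (not_le.2 (mul_pos (half_pos hα) hc))
    linarith [abs_nonpos_iff.1 h2]
  -- Lipschitz continuity of `τ`
  have hτlip : ∀ y y' : E, dist y x₀ < s ^ 2 → dist y' x₀ < s ^ 2 → |τ y - τ y'| ≤ 2 * M / α * dist y y' := by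
    intro y y' hy hy'
    obtain ⟨-, -, hq⟩ := hτ y hy
    obtain ⟨hw', h0', -⟩ := hτ y' hy'
    have h1 := hq (τ y') (Ioo_subset_Icc_self hw')
    have h2 : |ℓ (g (τ y') y - g 1 x₀)| ≤ M * dist y y' := by
      have e : ℓ (g (τ y') y - g 1 x₀) = ℓ (g (τ y') y - g (τ y') y') + ℓ (g (τ y') y' - g 1 x₀) := by
        rw [← _root_.map_add]; congr 1; abel
      rw [e, h0', add_zero]
      exact hℓg y y' hy hy' (τ y') (Ioo_subset_Icc_self hw')
    rw [abs_sub_comm] at h1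
    rw [div_mul_eq_mul_div, le_div_iff₀ hα]
    linarith
  have h2MC : 2 * M / α ≤ C / α := div_le_div_of_nonneg_right hC2M.le hα.le
  refine ⟨hs4, fun y hy t ht => ⟨(hder y hy t ht).1, (hder y hy t ht).2.2⟩, fun y y' hy hy' t ht t' ht' => ?_, τ, hτx₀,
    fun y hy => ⟨(hτ y hy).1, (hτ y hy).2.1, ?_⟩, fun y hy => (hτ y hy).2.2, fun y y' hy hy' => ⟨?_, ?_⟩⟩
  · -- joint Lipschitz bound with the constant `C`
    have h1 := hlip y y' hy hy' t ht t' ht'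
    have h2 : M * |t - t'| + M * dist y y' ≤ C * (|t - t'| + dist y y') := by
      rw [mul_add]
      exact add_le_add (mul_le_mul_of_nonneg_right hCM (abs_nonneg _)) (mul_le_mul_of_nonneg_right hCM dist_nonneg)
    exact h1.trans h2
  · -- `|τ y - 1| ≤ C / α * dist y x₀`
    have h1 := hτlip y x₀ hy hx₀s
    rw [hτx₀] at h1
    exact h1.trans (mul_le_mul_of_nonneg_right h2MC dist_nonneg)
  · exact (hτlip y y' hy hy').trans (mul_le_mul_of_nonneg_right h2MC dist_nonneg)
  · -- the Poincaré map
    obtain ⟨hw, -, -⟩ := hτ y hy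
    obtain ⟨hw', -, -⟩ := hτ y' hy'
    have h1 := hlip y y' hy hy' (τ y) (Ioo_subset_Icc_self hw) (τ y') (Ioo_subset_Icc_self hw')
    have h2 := hτlip y y' hy hy'
    have h4 : M * |τ y - τ y'| ≤ 2 * M ^ 2 / α * dist y y' :=
      calc M * |τ y - τ y'| ≤ M * (2 * M / α * dist y y') := mul_le_mul_of_nonneg_left h2 hM0.le
        _ = 2 * M ^ 2 / α * dist y y' := by ring
    have hMα : M * α ≤ M ^ 2 := by rw [sq]; exact mul_le_mul_of_nonneg_left hαM hM0.le
    have h6 : 2 * M ^ 2 / α + M ≤ C / α := by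
      rw [div_add' _ _ _ hα.ne', div_le_div_iff_of_pos_right hα]; linarith
    calc dist (g (τ y) y) (g (τ y') y') ≤ M * |τ y - τ y'| + M * dist y y' := h1
      _ ≤ 2 * M ^ 2 / α * dist y y' + M * dist y y' := by linarith
      _ = (2 * M ^ 2 / α + M) * dist y y' := by ring
      _ ≤ C / α * dist y y' := mul_le_mul_of_nonneg_right h6 dist_nonneg

end IsHyperbolicSemiflowModel

end Literature.Dynamics.Hyperbolic

end
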